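import Summits.CriticalPhenomena.PercolationContinuityZ3.Theorems.PercNearOneGluingAdditiveGluingCondADT
import HarnessLib

/-!
# Crux `PercNearOneGluing.AdditiveGluing` (stmt-CriticalPhenomena-4576) — the Ahlswede–Daykin / Harris
# four-event inequality for connectivity events of an ARBITRARY finite terminal set, CONDITIONED ON THE ISOLATION
# of vertex sets — part II: measure statements

Helper file (task `png-dp-al5`, gen 3; `--supports stmt-CriticalPhenomena-4576`); the terminal-SET version of
`…CondAD.lean` (three named terminals) and `…SepCapture.lean`.

Bond percolation with arbitrary edge probabilities on a finite vertex type (`μ = prodBernoulli w`), a finite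
set `Tm` of vertices ("terminals").  A TERMINAL EVENT is an event `{ω | P (↔)}` where `P` is a predicate of the
connection relation `↔` that only reads it on `Tm × Tm` monotonically: increasing if
`(∀ x y ∈ Tm, r x y → r' x y) → P r → P r'`, decreasing if the same with `r, r'` exchanged in the hypothesis
(hypotheses spelled out; no definition is introduced).  For a vertex set `W` write
`I_W = Tm ↮ W = {∀ t ∈ Tm, ∀ x ∈ W, t ↮ x}`.

**Theorem (`condADT_core`, measure form `condADT_two_sets` in part II).**  For increasing terminal events `A₁, A₂`, decreasing terminal events
`D₁, D₂` and vertex sets `S, T`: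

  `μ(A₁ ∩ D₁ ∩ I_S) · μ(A₂ ∩ D₂ ∩ I_T) ≤ μ(A₁ ∩ A₂ ∩ I_{S∩T}) · μ(D₁ ∩ D₂ ∩ I_{S∪T})`.

For `S = T = ∅` this is the Ahlswede–Daykin four-event inequality (Harris–FKG in product form); the point is
that it SURVIVES CONDITIONING ON THE ISOLATION EVENTS `I_S, I_T` (decreasing events, for which no FKG
structure is available in general), with the intersection/union bookkeeping of van den Berg–Kahn 2001 /
BHK 2006 Thm. 1.1.  Corollaries (`S = T = W`): given `I_W`, increasing terminal events are positively
correlated (`condHarrisT_isolated`, part II); with `Tm = {o,a,b}` one recovers `…CondAD.lean` and the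
separated-capture inequality `P(oa|b|c)·P(ob|a|c) ≤ P(oab|c)·P(o|a|b|c)` of `…SepCapture.lean`; with
`Tm = {o, a_i, a_j, b}`, `W = {a_k}` one gets the dilution-free five-terminal rows asked for by the AG(3)
certificate searches of this crux (memo SEPCAPTURE.md).  Terminal events are NOT measurable with respect to
the cluster of one vertex (or two), so this is not a case of BHK's Thms. 1.1–1.5; and given `I_W` the join of two
configurations does not preserve `I_W`, so it is not a case of Ahlswede–Daykin either.

## Proof

Verbatim the induction of `…SepCapture.lean` / `BHK2006.core` ([VandenbergKahn2001, proof of Thm. 1.2];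
[VandenbergHaggstromKahn2005, Thm. 1.1, pp. 3–5]): strong induction on the vertex set `U` of the restricted
model `G[U]`; if `Z := S ∩ T ∩ U = ∅`, the four functions theorem on the configuration lattice (the join of
`α ∈ A₁ ∩ D₁ ∩ I_S` and `β ∈ A₂ ∩ D₂ ∩ I_T` lies in `A₁ ∩ A₂`, the meet in `D₁ ∩ D₂ ∩ I_{S∪T}`); otherwise condition on the set `R` of
vertices of `U ∖ Z` with an open edge to `Z`: on `I_Z` every terminal event of `G[U]` is the same terminal
event of `G[U ∖ Z]` and `I_W` becomes `I_{(W∖Z) ∪ R}` (BHK's identity (6) for every terminal as a source), the law of `R` is a product weight, and Ahlswede–Daykin over `R` with the induction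
hypothesis for `G[U ∖ Z]` closes the step.

## References
* J. van den Berg, J. Kahn, Ann. Probab. 29 (2001) 123–126, Thm. 1.2 and its proof. [VandenbergKahn2001]
* J. van den Berg, O. Häggström, J. Kahn, RSA 29 (2006) 417–435, Thm. 1.1 (pp. 3–5). [VandenbergHaggstromKahn2005]
* R. Ahlswede, D. E. Daykin (1978) (Mathlib `four_functions_theorem_univ`).
-/

noncomputable section

open MeasureTheory
open Literature.Probability.LatticeModels (prodBernoulli)
open Literature.Probability.Percolation
open Literature.Probability.Percolation.BHK2006
open DecisionTree (ind ind_of_mem ind_of_not_mem ind_nonneg)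

namespace Summit.CriticalPhenomena.PercolationContinuityZ3.Theorems

open scoped Classical

variable {V : Type*}

/-! Local notations (no new definitions): `rAVT[U, Tm, W]` = the isolation event `Tm ↮ W` in `G[U]`;
`rEVT[U, P]` = the event of the predicate `P` of the reachability relation of `G[U]`. -/
local notation3 "rAVT[" U ", " Tm ", " W "]" => {ω : Set (Sym2 V) | ∀ t ∈ (Tm : Finset V), ω ∈ rD U t W}
local notation3 "rEVT[" U ", " P "]" =>
  {ω : Set (Sym2 V) | (P : (V → V → Prop) → Prop) (fun x y => (openGraph (ω ∩ edgesIn U)).Reachable x y)}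

/-! A terminal predicate `P : (V → V → Prop) → Prop` is INCREASING on `Tm` if
`∀ r r', (∀ x ∈ Tm, ∀ y ∈ Tm, r x y → r' x y) → P r → P r'` and DECREASING on `Tm` if
`∀ r r', (∀ x ∈ Tm, ∀ y ∈ Tm, r' x y → r x y) → P r → P r'` (either implies that `P` only reads `r` on
`Tm × Tm`).  (Spelled out as hypotheses; no definition is introduced.) -/

section Measure

variable [Fintype V]

/-- **Conditional Ahlswede–Daykin for terminal events (terminal set `Tm`), two isolation sets.**  For
increasing terminal predicates `A₁, A₂`, decreasing `D₁, D₂`, vertex sets `S, T`, `μ = prodBernoulli w`: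
`μ(A₁ ∩ D₁ ∩ I_S) · μ(A₂ ∩ D₂ ∩ I_T) ≤ μ(A₁ ∩ A₂ ∩ I_{S∩T}) · μ(D₁ ∩ D₂ ∩ I_{S∪T})`, where the predicate
`P` stands for the event `{ω | P (↔_ω)}` and `I_W = {∀ t ∈ Tm, ∀ x ∈ W, t ↮ x}`.
[cite: VandenbergKahn2001, Thm. 1.2 (pp. 124–126) — method; derived in this file] -/
theorem condADT_two_sets (w : Sym2 V → unitInterval) (Tm : Finset V)
    (A₁ A₂ D₁ D₂ : (V → V → Prop) → Prop)
    (hA₁ : (∀ r r' : V → V → Prop, (∀ x ∈ Tm, ∀ y ∈ Tm, r x y → r' x y) → A₁ r → A₁ r'))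
    (hA₂ : (∀ r r' : V → V → Prop, (∀ x ∈ Tm, ∀ y ∈ Tm, r x y → r' x y) → A₂ r → A₂ r'))
    (hD₁ : (∀ r r' : V → V → Prop, (∀ x ∈ Tm, ∀ y ∈ Tm, r' x y → r x y) → D₁ r → D₁ r'))
    (hD₂ : (∀ r r' : V → V → Prop, (∀ x ∈ Tm, ∀ y ∈ Tm, r' x y → r x y) → D₂ r → D₂ r'))
    (S T : Set V) :
    (prodBernoulli w).real ({ω | A₁ (fun x y => (openGraph ω).Reachable x y)} ∩ {ω | D₁ (fun x y => (openGraph ω).Reachable x y)} ∩ {ω | ∀ t ∈ Tm, ∀ x ∈ S, ω ∉ openConn t x}) *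
      (prodBernoulli w).real ({ω | A₂ (fun x y => (openGraph ω).Reachable x y)} ∩ {ω | D₂ (fun x y => (openGraph ω).Reachable x y)} ∩ {ω | ∀ t ∈ Tm, ∀ x ∈ T, ω ∉ openConn t x}) ≤
    (prodBernoulli w).real ({ω | A₁ (fun x y => (openGraph ω).Reachable x y)} ∩ {ω | A₂ (fun x y => (openGraph ω).Reachable x y)} ∩ {ω | ∀ t ∈ Tm, ∀ x ∈ (S ∩ T), ω ∉ openConn t x}) *
      (prodBernoulli w).real ({ω | D₁ (fun x y => (openGraph ω).Reachable x y)} ∩ {ω | D₂ (fun x y => (openGraph ω).Reachable x y)} ∩ {ω | ∀ t ∈ Tm, ∀ x ∈ (S ∪ T), ω ∉ openConn t x}) := by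
  set w' : Sym2 V → ℝ := fun e => (w e : ℝ) with hw'
  have hw0 : ∀ e, 0 ≤ w' e := fun e => (w e).2.1
  have hw1 : ∀ e, w' e ≤ 1 := fun e => (w e).2.2
  have hm : ∑ ω, weight w' ω = 1 := by
    have h1 := integral_prodBernoulli_eq_sum w fun _ => (1 : ℝ)
    simp only [integral_const, probReal_univ, smul_eq_mul, mul_one] at h1
    exact h1.symm
  have hE : ∀ ω : Set (Sym2 V), ω ∩ edgesIn (Finset.univ : Finset V) = ω := fun ω => by
    ext e
    simp only [Set.mem_inter_iff, edgesIn, Set.mem_setOf_eq, Finset.mem_univ, imp_true_iff, and_true]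
  have hDD : ∀ (s : V) (Z : Set V),
      rD (Finset.univ : Finset V) s Z = {ω : BondConfig V | ∀ x ∈ Z, ω ∉ openConn s x} := by
    intro s Z; ext ω; simp only [rD, hE, Set.mem_setOf_eq]; rfl
  have key := condADT_core w' hw0 hw1 hm Finset.univ Tm A₁ A₂ D₁ D₂ hA₁ hA₂ hD₁ hD₂ S T (by simp) (by simp)
  simp only [hE, hDD, Set.mem_setOf_eq] at key
  rw [TwoAvoidanceSets.real_eq_sum_ind, TwoAvoidanceSets.real_eq_sum_ind,
    TwoAvoidanceSets.real_eq_sum_ind, TwoAvoidanceSets.real_eq_sum_ind]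
  exact key

/-- **Conditional Harris given isolation (terminal set `Tm`, increasing events).**  Given `I_W = Tm ↮ W`, two
increasing terminal events are positively correlated: `μ(A ∩ I_W) · μ(B ∩ I_W) ≤ μ(A ∩ B ∩ I_W) · μ(I_W)`.
[cite: VandenbergKahn2001, Thm. 1.2 (pp. 124–126) — method; derived in this file] -/
theorem condHarrisT_isolated (w : Sym2 V → unitInterval) (Tm : Finset V) (A B : (V → V → Prop) → Prop)
    (hA : (∀ r r' : V → V → Prop, (∀ x ∈ Tm, ∀ y ∈ Tm, r x y → r' x y) → A r → A r'))
    (hB : (∀ r r' : V → V → Prop, (∀ x ∈ Tm, ∀ y ∈ Tm, r x y → r' x y) → B r → B r'))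
    (W : Set V) :
    (prodBernoulli w).real ({ω | A (fun x y => (openGraph ω).Reachable x y)} ∩ {ω | ∀ t ∈ Tm, ∀ x ∈ W, ω ∉ openConn t x}) * (prodBernoulli w).real ({ω | B (fun x y => (openGraph ω).Reachable x y)} ∩ {ω | ∀ t ∈ Tm, ∀ x ∈ W, ω ∉ openConn t x}) ≤
    (prodBernoulli w).real ({ω | A (fun x y => (openGraph ω).Reachable x y)} ∩ {ω | B (fun x y => (openGraph ω).Reachable x y)} ∩ {ω | ∀ t ∈ Tm, ∀ x ∈ W, ω ∉ openConn t x}) * (prodBernoulli w).real {ω | ∀ t ∈ Tm, ∀ x ∈ W, ω ∉ openConn t x} := by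
  have key := condADT_two_sets w Tm A B (fun _ => True) (fun _ => True) hA hB
    (fun _ _ _ _ => trivial) (fun _ _ _ _ => trivial) W W
  simp only [Set.setOf_true, Set.inter_univ, Set.inter_self, Set.union_self, Set.univ_inter] at key
  exact key

/-- **Conditional Harris given isolation (terminal set `Tm`, mixed signs).**  Given `I_W = Tm ↮ W`, an
increasing and a decreasing terminal event are negatively correlated:
`μ(A ∩ D ∩ I_W) · μ(I_W) ≤ μ(A ∩ I_W) · μ(D ∩ I_W)`.
[cite: VandenbergKahn2001, Thm. 1.2 (pp. 124–126) — method; derived in this file] -/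
theorem condHarrisT_isolated_mixed (w : Sym2 V → unitInterval) (Tm : Finset V)
    (A D : (V → V → Prop) → Prop)
    (hA : (∀ r r' : V → V → Prop, (∀ x ∈ Tm, ∀ y ∈ Tm, r x y → r' x y) → A r → A r'))
    (hD : (∀ r r' : V → V → Prop, (∀ x ∈ Tm, ∀ y ∈ Tm, r' x y → r x y) → D r → D r'))
    (W : Set V) :
    (prodBernoulli w).real ({ω | A (fun x y => (openGraph ω).Reachable x y)} ∩ {ω | D (fun x y => (openGraph ω).Reachable x y)} ∩ {ω | ∀ t ∈ Tm, ∀ x ∈ W, ω ∉ openConn t x}) * (prodBernoulli w).real {ω | ∀ t ∈ Tm, ∀ x ∈ W, ω ∉ openConn t x} ≤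
    (prodBernoulli w).real ({ω | A (fun x y => (openGraph ω).Reachable x y)} ∩ {ω | ∀ t ∈ Tm, ∀ x ∈ W, ω ∉ openConn t x}) * (prodBernoulli w).real ({ω | D (fun x y => (openGraph ω).Reachable x y)} ∩ {ω | ∀ t ∈ Tm, ∀ x ∈ W, ω ∉ openConn t x}) := by
  have key := condADT_two_sets w Tm A (fun _ => True) D (fun _ => True) hA (fun _ _ _ _ => trivial) hD
    (fun _ _ _ _ => trivial) W W
  simp only [Set.setOf_true, Set.inter_univ, Set.inter_self, Set.union_self, Set.univ_inter] at key
  exact key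

end Measure

end Summit.CriticalPhenomena.PercolationContinuityZ3.Theorems

end
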